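import Summits.AtomisticToContinuum.Crystallization.Theorems.LayeredLawsSelectHcp.Negative.FccEnergy

/-!
# Negative knowledge for crux `LayeredLawsSelectHcp` (stmt-AtomisticToContinuum-9226), XV:
# a certified bound on the threshold, `e* ≤ −1/2`

Part XV (`--supports stmt-AtomisticToContinuum-9226`). `energyPerParticle_fccPC_one_le` (`e(fcc at nearest-neighbour distance 1) ≤ −1/2`: in the lattice sum of part V the
twelve touching neighbours contribute `−1/12` each and every other term is `≤ 0` by the tree's
`LennardJonesClusters.lennardJones_nonpos`, `shell_fccD3` / `le_dist_of_mem_fccD3`),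
and **`eStar_le_neg_half : e* ≤ −1/2`** by `eStar_le` (item 0714). So the crux's threshold is certifiably negative:
every minimising law has `E_P[h] ≤ −1/2`, and a would-be refutation needs a layered non-hcp law of mean root energy
`≤ −1/2` whose value is certified against every periodic competitor (true value `≈ −0.7176`, printed only; certified
lower bound in tree `−2³²/12`, `Blocks.neg_le_energyPerParticle`). All `[folklore]`.
-/

noncomputable section

namespace Summit.AtomisticToContinuum.Crystallization.Theorems.LayeredLawsSelectHcp.Negative.Threshold

open MeasureTheory Set
open Literature.MathematicalPhysics.StatisticalMechanics Literature.Geometry.DiscreteGeometry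
open Summit.AtomisticToContinuum.Crystallization.Theses.PalmUnimodularRigidity (LayeredLawsSelectHcp)
open Summit.AtomisticToContinuum.Crystallization.Theorems.ChargedEnergyGapNegative
  (eStar eStar_le bddBelow_energyPerParticle_lennardJones)
open Summit.AtomisticToContinuum.Crystallization.Theorems.LayeredLawsSelectHcp.Negative.DiracLaws
open Summit.AtomisticToContinuum.Crystallization.Theorems.LayeredLawsSelectHcp.Negative.IntegerForms
open Summit.AtomisticToContinuum.Crystallization.Theorems.LayeredLawsSelectHcp.Negative.FccLattice
open Summit.AtomisticToContinuum.Crystallization.Theorems.LayeredLawsSelectHcp.Negative.FccModel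
open Summit.AtomisticToContinuum.Crystallization.Theorems.LayeredLawsSelectHcp.Negative.FccEnergy

/-- Euclidean `3`-space. [folklore] -/
local notation "E3" => EuclideanSpace ℝ (Fin 3)

/-! ## A certified bound on the threshold: `e* ≤ e(fcc, a = 1) ≤ −1/2` -/

section Threshold

/-- **`e(fcc at nearest-neighbour distance 1) ≤ −1/2`**: the twelve touching neighbours contribute
`12 · (−1/12)` to the (doubled) energy and every other term is `≤ 0`. [folklore] -/
theorem energyPerParticle_fccPC_one_le : (fccPC one_ne_zero).energyPerParticle lennardJones ≤ -1 / 2 := by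
  classical
  rw [energyPerParticle_fccPC]
  set T := {y : E3 // y ∈ (fccD3 1 : Set E3) ∧ y ≠ 0}
  set f : T → ℝ := fun y => lennardJones ‖(y : E3)‖ with hf
  have hsum : Summable f := (summable_abs_lennardJones_fccD3 one_ne_zero).of_abs
  -- every term is ≤ 0
  have hnonpos : ∀ y : T, f y ≤ 0 := fun y => by
    have h1 : (1 : ℝ) ≤ ‖(y : E3)‖ := by
      have := le_dist_of_mem_fccD3 one_pos y.2.1 (fccD3 1).zero_mem y.2.2
      rwa [dist_zero_right] at this
    exact lennardJones_nonpos h1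
  -- the twelve touching neighbours, as a finset of `T`
  let g : (Fin 3 → ℤ) → E3 := fun v => cs 1 • intVec v
  have hg : Function.Injective g := (smul_right_injective E3 (cs_pos one_pos).ne').comp intVec_injective
  let S : Finset T := (fccInt.image g).subtype fun y => y ∈ (fccD3 1 : Set E3) ∧ y ≠ 0
  have hSval : ∀ y ∈ S, f y = -1 / 12 := by
    intro y hy
    rw [Finset.mem_subtype] at hy
    obtain ⟨v, hv, hyv⟩ := Finset.mem_image.1 hy
    have hn : ‖(y : E3)‖ = 1 := by
      have h := (shell_fccD3 one_pos (z := (y : E3))).2 ⟨v, hv, hyv.symm⟩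
      have hs : sqNormInt v = 2 := by exact_mod_cast sqNormInt_fccInt v hv
      rw [← hyv, norm_smul_intVec, abs_of_pos (cs_pos one_pos), hs]
      push_cast
      exact cs_mul_sqrt_two 1
    simp only [hf, hn, lennardJones_one]
  have hScard : S.card = 12 := by
    have hall : ∀ y ∈ fccInt.image g, y ∈ (fccD3 1 : Set E3) ∧ y ≠ 0 := by
      intro y hy
      obtain ⟨v, hv, rfl⟩ := Finset.mem_image.1 hy
      have h := (shell_fccD3 one_pos (z := g v)).2 ⟨v, hv, rfl⟩
      exact ⟨h.1, h.2.1⟩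
    rw [Finset.card_subtype, Finset.filter_true_of_mem hall, Finset.card_image_of_injective _ hg,
      card_fccInt]
  have hsplit := hsum.sum_add_tsum_compl (s := S)
  have hS : ∑ y ∈ S, f y = -1 := by
    rw [Finset.sum_congr rfl hSval, Finset.sum_const, hScard]; norm_num
  have htail : ∑' y : ↥((↑S : Set T)ᶜ), f y ≤ 0 := tsum_nonpos fun y => hnonpos y
  have : ∑' y : T, f y ≤ -1 := by rw [← hsplit, hS]; linarith
  linarith

/-- **A certified upper bound on the crux's threshold: `e* ≤ −1/2`.** So every minimising law has mean
root energy `≤ −1/2`, and any would-be refutation needs a layered non-hcp law of root energy `≤ −1/2`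
whose value is moreover certified against EVERY periodic competitor. (The true value is `≈ −0.7176`,
printed; the certified LOWER bound in tree is `−2³²/12`.) [folklore] -/
theorem eStar_le_neg_half : eStar ≤ -1 / 2 :=
  (eStar_le _).trans energyPerParticle_fccPC_one_le

end Threshold

end Summit.AtomisticToContinuum.Crystallization.Theorems.LayeredLawsSelectHcp.Negative.Threshold

end
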